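import Mathlib
import HarnessLib

/-!
# The quaternion group `Q₈` coded as `Fin 2 × ZMod 4` and its spin-½ representation

Topic `MathematicalPhysics/QuantumLattice`; definition request `defn-spinGaugedHubbardTorus` (route
`HubbardSuperconductivity/ColourTheSpin`), part 1 of 3: the finite spin gauge group. The route inlines
the quaternion group `Q₈ = ⟨a, x | a⁴ = 1, x² = a², x a x⁻¹ = a⁻¹⟩ ⊂ SU(2)` in every item as the
type `Fin 2 × ZMod 4` with `(0, i) = aⁱ`, `(1, i) = x aⁱ`, the multiplication
`m u v = (u.1 + v.1, …)`, the inverse `iv u = (u.1, …)` and the faithful two-dimensional unitary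
representation `r (j, i)`: `ρ(aⁱ) = diag(Iⁱ, (-I)ⁱ)`, `ρ(x aⁱ) = [[0, -(-I)ⁱ], [Iⁱ, 0]]`. Here

* `Q8` is that type as a type synonym (so that the componentwise ring structure of the product is
  NOT inherited), with `Group Q8` whose `*`, `⁻¹`, `1` are LITERALLY the route's `m`, `iv`, `(0,0)`
  (`Q8.mul_def`, `Q8.inv_def` are `rfl`); the group axioms are checked by `decide`;
* `Q8.mulEquivQuaternionGroup : Q8 ≃* QuaternionGroup 2` identifies it with Mathlib's generalised
  quaternion group (`a i ↦ (0, i)`, `xa i ↦ (1, i)`), so `Fintype.card Q8 = 8`, the presentation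
  `a⁴ = 1, x² = a², x a x⁻¹ = a⁻¹` (`Q8.relations`) and every abstract fact about `Q₈` are available;
* `Q8.rep : Q8 →* Matrix (Fin 2) (Fin 2) ℂ` is the spin-½ representation, whose underlying function
  is LITERALLY the route's `r` (`Q8.rep_apply` is `rfl`). It is obtained from an integral model
  `Q8.repGI : Q8 → Matrix (Fin 2) (Fin 2) ℤ[i]` (Gaussian-integer entries `0, ±1, ±i`), on which
  multiplicativity, unitarity, `det = 1`, `ρᵀ ε ρ = ε` (`ε = [[0,1],[-1,0]]`, the singlet metric),
  `Σ_{u ∈ Q₈} ρ(u) = 0`, reality of the characters and faithfulness are DECIDED, and then transported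
  along `GaussianInt.toComplex`: `Q8.rep_mem_unitaryGroup`, `Q8.det_rep`,
  `Q8.rep_mem_specialUnitaryGroup`, `Q8.transpose_rep_mul_eps_mul_rep`, `Q8.sum_rep`,
  `Q8.star_trace_rep`, `Q8.rep_injective`.

These are exactly the finite-group inputs of the spin-gauged Hubbard torus
(`SpinGaugedHubbardTorus.lean`): unitarity and `det = 1` give gauge invariance of the hopping and of
the transported singlet pair field, real characters give hermiticity of the magnetic term, and
`Σ ρ = 0` (no invariant vector in the spin-½ and, a fortiori, in the spin-1 representation) is the
input of the Hamiltonian Elitzur lemma.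

## Sources

The quaternion group and its embedding in `SU(2)` as the lift of the Klein four-group
`V₄ ⊂ SO(3)`: folklore (e.g. Conway–Smith, *On Quaternions and Octonions* §3); Mathlib's
`QuaternionGroup n` (generalised quaternion / dicyclic groups, `a i`, `xa i`). Spin gauge groups in
Hamiltonian lattice gauge theory: Kogut–Susskind, Phys. Rev. D 11 (1975) 395; Bietenholz–Wiese
(2025) §11.8.

## Mathlib / tree search

Mathlib: `QuaternionGroup`, `QuaternionGroup.card`, `Matrix.unitaryGroup`,
`Matrix.specialUnitaryGroup`, `GaussianInt.toComplex` (`toComplex_star`, `toComplex_injective`),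
`RingHom.mapMatrix`, `Matrix.det_fin_two`. No two-dimensional representation of `QuaternionGroup` in
Mathlib (`rg "QuaternionGroup" Mathlib/RepresentationTheory`: nothing). Tree: nothing on `Q₈`.
-/

namespace Literature.MathematicalPhysics.QuantumLattice

open Matrix

/-- The quaternion group `Q₈ = ⟨a, x | a⁴ = 1, x² = a², x a x⁻¹ = a⁻¹⟩` coded as `Fin 2 × ZMod 4`:
`(0, i) = aⁱ`, `(1, i) = x aⁱ`. A type synonym: the product's componentwise ring structure is not
inherited, the group law is `Q8.instGroup`. [folklore] -/
def Q8 : Type := Fin 2 × ZMod 4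

namespace Q8

/-- Equality in `Q₈` is decidable (it is `Fin 2 × ZMod 4`). [folklore] -/
instance instDecidableEq : DecidableEq Q8 := inferInstanceAs (DecidableEq (Fin 2 × ZMod 4))

/-- `Q₈` is finite (it is `Fin 2 × ZMod 4`). [folklore] -/
instance instFintype : Fintype Q8 := inferInstanceAs (Fintype (Fin 2 × ZMod 4))

/-- The element `xʲ aⁱ` of `Q₈`, i.e. the pair `(j, i)`. [folklore] -/
def mk (j : Fin 2) (i : ZMod 4) : Q8 := (j, i)

/-- The multiplication of `Q₈` in the coding `(0,i) = aⁱ, (1,i) = x aⁱ`: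
`aⁱ aʲ = aⁱ⁺ʲ`, `aⁱ (x aʲ) = x aʲ⁻ⁱ`, `(x aⁱ) aʲ = x aⁱ⁺ʲ`, `(x aⁱ)(x aʲ) = a²⁺ʲ⁻ⁱ` — literally the
`m` inlined in the items of route ColourTheSpin (and Mathlib's `QuaternionGroup` law, `n = 2`).
[folklore] -/
def mulFn (u v : Q8) : Q8 :=
  (u.1 + v.1, if u.1 = 0 then (if v.1 = 0 then u.2 + v.2 else v.2 - u.2)
    else if v.1 = 0 then u.2 + v.2 else 2 + v.2 - u.2)

/-- The inversion of `Q₈`: `(aⁱ)⁻¹ = a⁻ⁱ`, `(x aⁱ)⁻¹ = x aⁱ⁺²` — literally the route's `iv`.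
[folklore] -/
def invFn (u : Q8) : Q8 := (u.1, if u.1 = 0 then -u.2 else u.2 + 2)

/-- The identity `a⁰ = (0, 0)` of `Q₈`. [folklore] -/
def oneFn : Q8 := ((0 : Fin 2), (0 : ZMod 4))

/-- **The group `Q₈`** on the coded type, with `*`, `⁻¹`, `1` definitionally the explicit formulas
`mulFn`, `invFn`, `oneFn`; the axioms are finite checks. [folklore] -/
instance instGroup : Group Q8 where
  mul := mulFn
  one := oneFn
  inv := invFn
  mul_assoc := by decide
  one_mul := by decide
  mul_one := by decide
  inv_mul_cancel := by decide

/-- `u * v` is the route's multiplication formula (definitional). [folklore] -/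
theorem mul_def (u v : Q8) :
    u * v = (u.1 + v.1, if u.1 = 0 then (if v.1 = 0 then u.2 + v.2 else v.2 - u.2)
      else if v.1 = 0 then u.2 + v.2 else 2 + v.2 - u.2) := rfl

/-- `u⁻¹` is the route's inversion formula (definitional). [folklore] -/
theorem inv_def (u : Q8) : u⁻¹ = (u.1, if u.1 = 0 then -u.2 else u.2 + 2) := rfl

/-- `1 = (0, 0)` (definitional). [folklore] -/
theorem one_def : (1 : Q8) = ((0 : Fin 2), (0 : ZMod 4)) := rfl

/-- The generator `a = (0, 1)` (order `4`). [folklore] -/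
def a : Q8 := ((0 : Fin 2), (1 : ZMod 4))

/-- The generator `x = (1, 0)` (order `4`, `x² = a²`). [folklore] -/
def x : Q8 := ((1 : Fin 2), (0 : ZMod 4))

/-- **The presentation** `a⁴ = 1`, `x² = a²`, `x a x⁻¹ = a⁻¹` (and `a² ≠ 1`: `a²` is the central
element `-1`). [folklore] -/
theorem relations : a ^ 4 = 1 ∧ x ^ 2 = a ^ 2 ∧ x * a * x⁻¹ = a⁻¹ ∧ a ^ 2 ≠ 1 := by decide

/-- Every element is `xʲ aⁱ`: `(j, i) = x ^ j * a ^ i`. [folklore] -/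
theorem mk_eq_pow_mul_pow : ∀ (j : Fin 2) (i : ZMod 4), mk j i = x ^ j.val * a ^ i.val := by decide

/-- `Q₈` has eight elements. [folklore] -/
theorem card : Fintype.card Q8 = 8 := rfl

/-! ### Identification with Mathlib's `QuaternionGroup 2` -/

/-- The coding map `(0, i) ↦ a i`, `(1, i) ↦ xa i` to Mathlib's generalised quaternion group.
[folklore] -/
def toQuaternionGroup (u : Q8) : QuaternionGroup 2 :=
  if u.1 = 0 then QuaternionGroup.a u.2 else QuaternionGroup.xa u.2

/-- The decoding map `a i ↦ (0, i)`, `xa i ↦ (1, i)`. [folklore] -/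
def ofQuaternionGroup : QuaternionGroup 2 → Q8
  | QuaternionGroup.a i => ((0 : Fin 2), i)
  | QuaternionGroup.xa i => ((1 : Fin 2), i)

/-- The coding map is multiplicative. [folklore] -/
theorem toQuaternionGroup_mul :
    ∀ u v : Q8, toQuaternionGroup (u * v) = toQuaternionGroup u * toQuaternionGroup v := by
  decide

/-- Decoding inverts coding. [folklore] -/
theorem ofQuaternionGroup_toQuaternionGroup : ∀ u : Q8, ofQuaternionGroup (toQuaternionGroup u) = u := by
  decide

/-- Coding inverts decoding. [folklore] -/
theorem toQuaternionGroup_ofQuaternionGroup :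
    ∀ q : QuaternionGroup 2, toQuaternionGroup (ofQuaternionGroup q) = q := by
  decide

/-- **`Q8 ≃* QuaternionGroup 2`**: the coded quaternion group is Mathlib's generalised quaternion
group of order `8`. [folklore] -/
def mulEquivQuaternionGroup : Q8 ≃* QuaternionGroup 2 where
  toFun := toQuaternionGroup
  invFun := ofQuaternionGroup
  left_inv := ofQuaternionGroup_toQuaternionGroup
  right_inv := toQuaternionGroup_ofQuaternionGroup
  map_mul' := toQuaternionGroup_mul

/-- The coding map on generators: `a ↦ a 1`, `x ↦ xa 0`. [folklore] -/
theorem mulEquivQuaternionGroup_a_x :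
    mulEquivQuaternionGroup a = QuaternionGroup.a 1 ∧
      mulEquivQuaternionGroup x = QuaternionGroup.xa 0 := by
  decide

/-! ### The spin-½ representation: integral model over `ℤ[i]` -/

/-- The Gaussian integer `i`. [folklore] -/
def gi : GaussianInt := ⟨0, 1⟩

/-- The spin-½ representation with Gaussian-integer entries: `ρ(aⁱ) = diag(iⁱ, (-i)ⁱ)`,
`ρ(x aⁱ) = [[0, -(-i)ⁱ], [iⁱ, 0]]` (row index `σ`, column index `τ`). [folklore] -/
def repGI (u : Q8) : Matrix (Fin 2) (Fin 2) GaussianInt :=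
  Matrix.of fun σ τ =>
    if u.1 = 0 then (if σ = τ then (if σ = 0 then gi else -gi) ^ u.2.val else 0)
    else if σ = τ then 0 else if σ = 0 then -(-gi) ^ u.2.val else gi ^ u.2.val

/-- The singlet metric `ε = [[0, 1], [-1, 0]]` over `ℤ[i]`. [folklore] -/
def epsGI : Matrix (Fin 2) (Fin 2) GaussianInt := !![0, 1; -1, 0]

/-- `ρ` is multiplicative (checked on all `64` pairs). [folklore] -/
theorem repGI_mul : ∀ u v : Q8, repGI (u * v) = repGI u * repGI v := by decide

/-- `ρ(1) = 1`. [folklore] -/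
theorem repGI_one : repGI 1 = 1 := by decide

/-- `ρ(u)` is unitary: `ρ(u)ᴴ ρ(u) = 1`. [folklore] -/
theorem conjTranspose_repGI_mul_self : ∀ u : Q8, (repGI u)ᴴ * repGI u = 1 := by decide

/-- `ρ(u⁻¹) = ρ(u)ᴴ`. [folklore] -/
theorem repGI_inv : ∀ u : Q8, repGI u⁻¹ = (repGI u)ᴴ := by decide

/-- `det ρ(u) = 1` (in the `2 × 2` expansion). [folklore] -/
theorem repGI_det_formula : ∀ u : Q8, repGI u 0 0 * repGI u 1 1 - repGI u 0 1 * repGI u 1 0 = 1 := by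
  decide

/-- **`ρᵀ ε ρ = ε`**: `ρ(u)` preserves the singlet metric (equivalently `det ρ = 1` for `2 × 2`
matrices), so the singlet pair `Σ ε_{στ} c_σ c_τ` is `Q₈`-invariant. [folklore] -/
theorem transpose_repGI_mul_epsGI_mul_repGI : ∀ u : Q8, (repGI u)ᵀ * epsGI * repGI u = epsGI := by
  decide

/-- **`Σ_{u ∈ Q₈} ρ(u) = 0`**: the spin-½ representation has no invariant vector. [folklore] -/
theorem sum_repGI : ∑ u : Q8, repGI u = 0 := by decide

/-- The characters are real (indeed `tr ρ(u) ∈ {2, -2, 0}`): the trace has no imaginary part.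
[folklore] -/
theorem repGI_trace_im : ∀ u : Q8, (repGI u 0 0 + repGI u 1 1).im = 0 := by decide

/-- `tr ρ(u) ∈ {2, -2, 0}`, and `tr ρ(u) = 2` iff `u = 1`. [folklore] -/
theorem repGI_trace_mem : ∀ u : Q8,
    (repGI u 0 0 + repGI u 1 1 = 2 ∨ repGI u 0 0 + repGI u 1 1 = -2 ∨ repGI u 0 0 + repGI u 1 1 = 0) ∧
      (repGI u 0 0 + repGI u 1 1 = 2 ↔ u = 1) := by
  decide

/-- The representation is faithful. [folklore] -/
theorem repGI_injective : Function.Injective repGI := by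
  intro u v
  revert u v
  decide

/-- **Group averaging kills traceless matrices** (Schur for the irreducible spin-½ representation of
`Q₈`, integral form): `Σ_u ρ(u)ᴴ E ρ(u) = 4 (tr E) · 1` on the four matrix units `E`. [folklore] -/
theorem sum_conjTranspose_repGI_mul_single_mul_repGI : ∀ α β : Fin 2,
    ∑ u : Q8, (repGI u)ᴴ * Matrix.single α β 1 * repGI u = if α = β then 4 else 0 := by
  decide

/-! ### The spin-½ representation over `ℂ` -/

/-- The spin-½ representation matrices over `ℂ`, as the explicit function inlined in the route items
(`r u σ τ`): `ρ(aⁱ) = diag(Iⁱ, (-I)ⁱ)`, `ρ(x aⁱ) = [[0, -(-I)ⁱ], [Iⁱ, 0]]`. [folklore] -/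
def repFn (u : Q8) : Matrix (Fin 2) (Fin 2) ℂ := fun σ τ =>
  if u.1 = 0 then (if σ = τ then (if σ = 0 then Complex.I else -Complex.I) ^ u.2.val else 0)
  else if σ = τ then 0 else if σ = 0 then -(-Complex.I) ^ u.2.val else Complex.I ^ u.2.val

/-- `toComplex i = I`. [folklore] -/
theorem toComplex_gi : GaussianInt.toComplex gi = Complex.I := by
  rw [gi, GaussianInt.toComplex_def']
  simp

/-- The complex representation is the Gaussian-integer one read in `ℂ`. [folklore] -/
theorem repFn_eq_map (u : Q8) : repFn u = GaussianInt.toComplex.mapMatrix (repGI u) := by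
  ext σ τ
  simp only [repFn, repGI, RingHom.mapMatrix_apply, Matrix.map_apply, Matrix.of_apply]
  split_ifs <;> simp [map_pow, map_neg, toComplex_gi]

/-- **The spin-½ representation `ρ : Q₈ →* Mat₂(ℂ)`**, a monoid homomorphism whose underlying
function is the route's `r`. [folklore] -/
def rep : Q8 →* Matrix (Fin 2) (Fin 2) ℂ where
  toFun := repFn
  map_one' := by
    rw [repFn_eq_map, repGI_one, map_one]
  map_mul' u v := by
    rw [repFn_eq_map, repFn_eq_map, repFn_eq_map, repGI_mul, map_mul]

/-- `ρ(u)_{στ}` unfolds to the route's explicit formula (definitional). [folklore] -/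
theorem rep_apply (u : Q8) (σ τ : Fin 2) :
    rep u σ τ = (if u.1 = 0 then (if σ = τ then (if σ = 0 then Complex.I else -Complex.I) ^ u.2.val else 0)
      else if σ = τ then 0 else if σ = 0 then -(-Complex.I) ^ u.2.val else Complex.I ^ u.2.val) :=
  rfl

/-- `ρ(u)` over `ℂ` is the image of the integral model. [folklore] -/
theorem rep_eq_map (u : Q8) : rep u = GaussianInt.toComplex.mapMatrix (repGI u) := repFn_eq_map u

/-- `toComplex` commutes with `star` (complex conjugation). [folklore] -/
theorem semiconj_toComplex_star :
    Function.Semiconj GaussianInt.toComplex star star := fun z => by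
  rw [GaussianInt.toComplex_star]
  rfl

/-- `mapMatrix toComplex` commutes with the conjugate transpose. [folklore] -/
theorem mapMatrix_conjTranspose {m : Type*} [Fintype m] [DecidableEq m] (M : Matrix m m GaussianInt) :
    GaussianInt.toComplex.mapMatrix Mᴴ = (GaussianInt.toComplex.mapMatrix M)ᴴ := by
  rw [RingHom.mapMatrix_apply, RingHom.mapMatrix_apply,
    Matrix.conjTranspose_map _ semiconj_toComplex_star]

/-- `mapMatrix toComplex` commutes with the transpose. [folklore] -/
theorem mapMatrix_transpose {m : Type*} [Fintype m] [DecidableEq m] (M : Matrix m m GaussianInt) :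
    GaussianInt.toComplex.mapMatrix Mᵀ = (GaussianInt.toComplex.mapMatrix M)ᵀ := by
  rw [RingHom.mapMatrix_apply, RingHom.mapMatrix_apply, Matrix.transpose_map]

/-- **`ρ(u)` is unitary.** [folklore] -/
theorem conjTranspose_rep_mul_self (u : Q8) : (rep u)ᴴ * rep u = 1 := by
  rw [rep_eq_map, ← mapMatrix_conjTranspose, ← map_mul, conjTranspose_repGI_mul_self, map_one]

/-- `ρ(u) ρ(u)ᴴ = 1`. [folklore] -/
theorem rep_mul_conjTranspose_self (u : Q8) : rep u * (rep u)ᴴ = 1 :=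
  mul_eq_one_comm.1 (conjTranspose_rep_mul_self u)

/-- `ρ(u) ∈ U(2)`. [folklore] -/
theorem rep_mem_unitaryGroup (u : Q8) : rep u ∈ Matrix.unitaryGroup (Fin 2) ℂ :=
  Matrix.mem_unitaryGroup_iff'.2 (conjTranspose_rep_mul_self u)

/-- `ρ(u⁻¹) = ρ(u)ᴴ`. [folklore] -/
theorem rep_inv (u : Q8) : rep u⁻¹ = (rep u)ᴴ := by
  rw [rep_eq_map, rep_eq_map, repGI_inv, mapMatrix_conjTranspose]

/-- **`det ρ(u) = 1`.** [folklore] -/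
theorem det_rep (u : Q8) : (rep u).det = 1 := by
  rw [Matrix.det_fin_two, rep_eq_map]
  simp only [RingHom.mapMatrix_apply, Matrix.map_apply, ← map_mul, ← map_sub, repGI_det_formula,
    map_one]

/-- `ρ(u) ∈ SU(2)`. [folklore] -/
theorem rep_mem_specialUnitaryGroup (u : Q8) : rep u ∈ Matrix.specialUnitaryGroup (Fin 2) ℂ :=
  Matrix.mem_specialUnitaryGroup_iff.2 ⟨rep_mem_unitaryGroup u, det_rep u⟩

/-- The singlet metric `ε = [[0, 1], [-1, 0]]` (`ε_{↑↓} = 1 = -ε_{↓↑}`). [folklore] -/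
def eps : Matrix (Fin 2) (Fin 2) ℂ := !![0, 1; -1, 0]

/-- `ε` over `ℂ` is the image of `ε` over `ℤ[i]`. [folklore] -/
theorem eps_eq_map : eps = GaussianInt.toComplex.mapMatrix epsGI := by
  ext i j
  fin_cases i <;> fin_cases j <;> simp [eps, epsGI]

/-- **`ρ(u)ᵀ ε ρ(u) = ε`**: the spin-½ representation preserves the singlet metric. [folklore] -/
theorem transpose_rep_mul_eps_mul_rep (u : Q8) : (rep u)ᵀ * eps * rep u = eps := by
  rw [rep_eq_map, eps_eq_map, ← mapMatrix_transpose, ← map_mul, ← map_mul,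
    transpose_repGI_mul_epsGI_mul_repGI]

/-- **`Σ_{u ∈ Q₈} ρ(u) = 0`.** [folklore] -/
theorem sum_rep : ∑ u : Q8, rep u = 0 := by
  simp only [rep_eq_map, ← map_sum, sum_repGI, map_zero]

/-- The characters are real: `star (tr ρ(u)) = tr ρ(u)`. [folklore] -/
theorem star_trace_rep (u : Q8) : star (rep u 0 0 + rep u 1 1) = rep u 0 0 + rep u 1 1 := by
  have h : rep u 0 0 + rep u 1 1 = GaussianInt.toComplex (repGI u 0 0 + repGI u 1 1) := by
    rw [rep_eq_map, map_add]
    rfl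
  rw [h, Complex.star_def, Complex.conj_eq_iff_im, ← GaussianInt.intCast_im, repGI_trace_im,
    Int.cast_zero]

/-- `tr ρ(u) = ρ(u)₀₀ + ρ(u)₁₁`. [folklore] -/
theorem trace_rep (u : Q8) : (rep u).trace = rep u 0 0 + rep u 1 1 :=
  Matrix.trace_fin_two _

/-- The representation over `ℂ` is faithful. [folklore] -/
theorem rep_injective : Function.Injective rep := by
  intro u v h
  apply repGI_injective
  have h' : (repGI u).map GaussianInt.toComplex = (repGI v).map GaussianInt.toComplex := by
    rw [← RingHom.mapMatrix_apply, ← RingHom.mapMatrix_apply, ← rep_eq_map, ← rep_eq_map, h]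
  exact Matrix.map_injective GaussianInt.toComplex_injective h'

/-- `ρ(1) = 1` entrywise: `ρ(1)_{στ} = δ_{στ}`. [folklore] -/
theorem rep_one_apply (σ τ : Fin 2) : rep 1 σ τ = if σ = τ then 1 else 0 := by
  rw [map_one, Matrix.one_apply]

/-- The generators: `ρ(a) = diag(I, -I)`, `ρ(x) = [[0, -1], [1, 0]]`. [folklore] -/
theorem rep_a_x : rep a = !![Complex.I, 0; 0, -Complex.I] ∧ rep x = !![0, -1; 1, 0] := by
  have h1 : (1 : ZMod 4).val = 1 := rfl
  have h0 : (0 : ZMod 4).val = 0 := rfl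
  constructor
  · ext σ τ
    fin_cases σ <;> fin_cases τ <;> simp [rep_apply, a, h1]
  · ext σ τ
    fin_cases σ <;> fin_cases τ <;> simp [rep_apply, x, h0]

/-- `4 = 4 · 1` in `Mat₂(ℂ)`. [folklore] -/
theorem four_eq_smul_one : (4 : Matrix (Fin 2) (Fin 2) ℂ) = (4 : ℂ) • (1 : Matrix (Fin 2) (Fin 2) ℂ) := by
  ext i j
  rw [Matrix.ofNat_apply, Matrix.smul_apply, Matrix.one_apply, smul_eq_mul, mul_ite, mul_one, mul_zero]
  split_ifs <;> simp

/-- **Schur averaging over `Q₈`**: `Σ_u ρ(u)ᴴ A ρ(u) = 4 (tr A) · 1` for every `2 × 2` matrix `A`;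
in particular the average of a traceless matrix (a spin component) vanishes — the algebraic input of
Elitzur's theorem for the spin-gauged model. [folklore] -/
theorem sum_conjTranspose_rep_mul_mul_rep (A : Matrix (Fin 2) (Fin 2) ℂ) :
    ∑ u : Q8, (rep u)ᴴ * A * rep u = (4 * A.trace) • (1 : Matrix (Fin 2) (Fin 2) ℂ) := by
  -- the identity on matrix units, transported from the decided integral identity
  have hunit : ∀ α β : Fin 2, ∑ u : Q8, (rep u)ᴴ * Matrix.single α β 1 * rep u =
      if α = β then (4 : Matrix (Fin 2) (Fin 2) ℂ) else 0 := by
    intro α β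
    have hs : (Matrix.single α β (1 : ℂ)) =
        GaussianInt.toComplex.mapMatrix (Matrix.single α β (1 : GaussianInt)) := by
      ext i j
      simp only [RingHom.mapMatrix_apply, Matrix.map_apply, Matrix.single_apply]
      split_ifs <;> simp
    have key := congrArg GaussianInt.toComplex.mapMatrix
      (sum_conjTranspose_repGI_mul_single_mul_repGI α β)
    rw [map_sum] at key
    simp only [map_mul, mapMatrix_conjTranspose, ← rep_eq_map, ← hs] at key
    rw [key]
    split_ifs
    · exact map_ofNat _ 4
    · exact map_zero _
  -- expand `A` in matrix units
  have hA : A = ∑ α : Fin 2, ∑ β : Fin 2, A α β • Matrix.single α β (1 : ℂ) := by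
    conv_lhs => rw [Matrix.matrix_eq_sum_single A]
    refine Finset.sum_congr rfl fun α _ => Finset.sum_congr rfl fun β _ => ?_
    rw [Matrix.smul_single, smul_eq_mul, mul_one]
  calc ∑ u : Q8, (rep u)ᴴ * A * rep u
      = ∑ u : Q8, ∑ α : Fin 2, ∑ β : Fin 2,
          A α β • ((rep u)ᴴ * Matrix.single α β 1 * rep u) := by
        refine Finset.sum_congr rfl fun u _ => ?_
        conv_lhs => rw [hA]
        simp only [Finset.mul_sum, Finset.sum_mul, Matrix.mul_smul, Matrix.smul_mul]
    _ = ∑ α : Fin 2, ∑ β : Fin 2, A α β • ∑ u : Q8, (rep u)ᴴ * Matrix.single α β 1 * rep u := by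
        rw [Finset.sum_comm]
        refine Finset.sum_congr rfl fun α _ => ?_
        rw [Finset.sum_comm]
        refine Finset.sum_congr rfl fun β _ => ?_
        rw [Finset.smul_sum]
    _ = ∑ α : Fin 2, ∑ β : Fin 2, A α β • (if α = β then (4 : Matrix (Fin 2) (Fin 2) ℂ) else 0) := by
        simp only [hunit]
    _ = (4 * A.trace) • (1 : Matrix (Fin 2) (Fin 2) ℂ) := by
        simp only [smul_ite, smul_zero, Finset.sum_ite_eq, Finset.mem_univ, if_true]
        rw [Fin.sum_univ_two, Matrix.trace_fin_two, ← add_smul, four_eq_smul_one, smul_smul, mul_comm]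

end Q8

end Literature.MathematicalPhysics.QuantumLattice
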